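import Summits.AnomalousDissipation.AnomalousDissipation.Theses.TwoAndHalfD
import Summits.AnomalousDissipation.AnomalousDissipation.Theorems.TwoAndHalfDTwohalfdNegCertificate
import Summits.AnomalousDissipation.AnomalousDissipation.Theorems.TwoAndHalfDTwohalfdNegPerForceCertificate
import Summits.AnomalousDissipation.AnomalousDissipation.Theorems.TwohalfdThesis.Negative.TwohalfdThesisFalseOfSubLogStrain
import Literature.Analysis.FluidPDE.LongTimeAverageNonneg

/-!
# Typed split of the crux `TwoAndHalfD.TwohalfdNeg` (stmt-AnomalousDissipation-0211) into two
# sub-cruxes: the planar law `SubLogStrain` and the scalar engine `ScalarQuietOfSubLogStrain`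

Crux-strategist decomposition (D-0019 glued split, two layers).  After two ideation rounds and
eleven lead seats every registered line of the crux chain ends at the SAME residual, the
two-dimensional Navier–Stokes law "bounded-energy steadily forced planar Leray–Hopf families have
sub-logarithmic `limsup`-mean strain" (`stub_subLogStrain`, in tree as the named conjecture
`Theorems.TwohalfdThesis.Negative.SubLogStrain`, p135209), while everything on the scalar side of
the line is a landed theorem.  This file records that state as a SPLIT THEOREM usable by
`ledger route edit --split TwohalfdNeg --into … --glue-by`:

* `TwohalfdNeg_of_subs : Sub₁ → Sub₂ → TwoAndHalfD.TwohalfdNeg` with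
  - `Sub₁` = the planar law (verbatim the body of the conjecture `SubLogStrain`): for every smooth
    divergence-free mean-zero `g` on `T²`, every `ν_j → 0` and every family of global Leray–Hopf
    solutions of NS_{ν_j} forced by `g` with `ν`-uniformly bounded `limsup`-mean energy,
    `⟨√‖∇v_j‖²⟩ / log(1/ν_j) → 0`;
  - `Sub₂` = the scalar engine at the resolution of ONE planar family (verbatim the statement of
    the landed `PerForce.scalarNoAnomaly_of_subLogStrain_family`): a sub-log-strain bounded-energy
    planar Leray–Hopf family carries every steadily sourced, bounded-variance weak scalar at
    `Pr = 1` with vanishing `limsup`-mean dissipation.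
  BOTH hypotheses are load-bearing in the proof (reduction S1' off `t = 0`, planar no-anomaly S2,
  `Sub₁` evaluated on the planar family, `Sub₂` applied to the sourced third component, squeeze);
  neither is the crux reworded: `Sub₁` speaks of planar velocities only (refutable by a
  bounded-energy planar family with super-logarithmic strain, which would NOT refute the crux),
  `Sub₂` is a statement about passive scalars over a GIVEN sub-log family (and is a theorem).
* `sub₁_iff_subLogStrain : Sub₁ ↔ Negative.SubLogStrain` (`Iff.rfl`) — child 1 IS the named
  conjecture, so its eventual proof / refutation by name closes / refutes the child.
* `sub₂_holds : Sub₂` — child 2 is already proved (`PerForce.scalarNoAnomaly_of_subLogStrain_family`,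
  composition S4 ⇒ S5' ⇒ S3'); after the split a one-line Theorems file
  `theorem … : TwoAndHalfD.ScalarQuietOfSubLogStrain := Split.sub₂_holds` closes it.

No new analysis.  Supports stmt-AnomalousDissipation-0211.
-/

namespace Summit.AnomalousDissipation.AnomalousDissipation.Theorems.TwohalfdNeg.Split

open MeasureTheory Filter Topology
open scoped ENNReal NNReal
open Literature.Analysis.FunctionSpaces Literature.Analysis.FluidPDE
open Summit.AnomalousDissipation.AnomalousDissipation.Theorems.TwohalfdNeg

set_option linter.dupNamespace false

/-- **Split theorem `TwohalfdNeg_of_subs : Sub₁ → Sub₂ → TwohalfdNeg`.**  `Sub₁` = sub-logarithmic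
`limsup`-mean strain of bounded-energy steadily forced planar Leray–Hopf families (the planar
law, = `Negative.SubLogStrain`); `Sub₂` = the per-family scalar engine (sub-log strain along a
bounded-energy planar family ⇒ every steadily sourced bounded-variance weak scalar over it has
vanishing `limsup`-mean dissipation).  Proof: split the `x₃`-invariant family off `t = 0`
(S1', `ReductionOffZero.stub_reductionOffZero`), planar dissipation `→ 0` (S2, Alexakis–Doering,
`PlanarNoAnomaly.stub_planarNoAnomaly`), `Sub₁` on the planar family, `Sub₂` on the sourced third
component, squeeze with `meanDissipation ≥ 0`. [folklore] -/
theorem TwohalfdNeg_of_subs :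
    (∀ g : UnitAddTorus (Fin 2) → EuclideanSpace ℝ (Fin 2),
      Torus.IsSmooth g → Torus.IsDivFree g → Torus.HasZeroMean g →
      ∀ (ν : ℕ → ℝ) (v₀ : ℕ → UnitAddTorus (Fin 2) → EuclideanSpace ℝ (Fin 2))
        (v : ℕ → ℝ → UnitAddTorus (Fin 2) → EuclideanSpace ℝ (Fin 2)),
        (∀ j, 0 < ν j) → Tendsto ν atTop (𝓝 0) →
        (∀ j, Torus.IsGlobalLerayHopf (ν j) (fun _ => g) (v₀ j) (v j)) →
        (∃ E : ℝ, ∀ j, meanEnergy (v j) ≤ E) →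
        Tendsto (fun j => longTimeAvgSup (fun t => Real.sqrt (Torus.eGradNormSq (v j t)).toReal) /
          Real.log (ν j)⁻¹) atTop (𝓝 0)) →
    (∀ (g : UnitAddTorus (Fin 2) → EuclideanSpace ℝ (Fin 2)) (h : UnitAddTorus (Fin 2) → ℝ),
      Torus.IsSmooth g → Torus.IsDivFree g → Torus.HasZeroMean g →
      Torus.IsSmooth h → Torus.HasZeroMean h →
      ∀ (ν : ℕ → ℝ) (v₀ : ℕ → UnitAddTorus (Fin 2) → EuclideanSpace ℝ (Fin 2))
        (v : ℕ → ℝ → UnitAddTorus (Fin 2) → EuclideanSpace ℝ (Fin 2))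
        (θ₀ : ℕ → UnitAddTorus (Fin 2) → ℝ) (θ : ℕ → ℝ → UnitAddTorus (Fin 2) → ℝ),
        (∀ j, 0 < ν j) → Tendsto ν atTop (𝓝 0) →
        (∀ j, Torus.IsGlobalLerayHopf (ν j) (fun _ => g) (v₀ j) (v j)) →
        (∃ E : ℝ, ∀ j, meanEnergy (v j) ≤ E) →
        Tendsto (fun j => longTimeAvgSup (fun t => Real.sqrt (Torus.eGradNormSq (v j t)).toReal) /
          Real.log (ν j)⁻¹) atTop (𝓝 0) →
        (∀ j, MemLp (θ₀ j) 2 volume) →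
        (∀ j, Torus.IsWeakScalarTransportForced (ν j) (v j) (fun _ => h) (θ₀ j) (θ j)) →
        (∃ E : ℝ, ∀ j, longTimeAvgSup (fun t => Torus.scalarL2Sq (θ j t)) ≤ E) →
        Tendsto (fun j => longTimeAvgSup (fun t => ν j * (Torus.eScalarGradNormSq (θ j t)).toReal))
          atTop (𝓝 0)) →
    Summit.AnomalousDissipation.AnomalousDissipation.Theses.TwoAndHalfD.TwohalfdNeg := by
  intro hS6 hEngine f hfinv hfs hfd hfz ν u₀ u hν hν0 hLH huinv hE
  obtain ⟨g, h, v₀, v, θ₀, θ, hgs, hgd, hgz, hhs, hhz, -, -, hvLH, hθ₀, hθw, hEv, hEθ, hsplit⟩ :=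
    ReductionOffZero.stub_reductionOffZero f hfinv hfs hfd hfz ν u₀ u hν hLH huinv hE
  have hplanar : Tendsto (fun j => meanDissipation (ν j) (v j)) atTop (𝓝 0) :=
    PlanarNoAnomaly.stub_planarNoAnomaly g hgs hgd hgz ν v₀ v hν hν0 hvLH hEv
  have hsub := hS6 g hgs hgd hgz ν v₀ v hν hν0 hvLH hEv
  have hscalar : Tendsto (fun j => longTimeAvgSup
      (fun t => ν j * (Torus.eScalarGradNormSq (θ j t)).toReal)) atTop (𝓝 0) :=
    hEngine g h hgs hgd hgz hhs hhz ν v₀ v θ₀ θ hν hν0 hvLH hEv hsub hθ₀ hθw hEθ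
  have hsum : Tendsto (fun j => meanDissipation (ν j) (v j) +
      longTimeAvgSup (fun t => ν j * (Torus.eScalarGradNormSq (θ j t)).toReal)) atTop (𝓝 0) := by
    simpa using hplanar.add hscalar
  exact squeeze_zero (fun j => meanDissipation_nonneg (hν j).le (u j)) hsplit hsum

/-- **Child 1 is the named conjecture.**  The first hypothesis of `TwohalfdNeg_of_subs` is,
verbatim, the body of `Theorems.TwohalfdThesis.Negative.SubLogStrain` (`Iff.rfl`). [folklore] -/
theorem sub₁_iff_subLogStrain :
    (∀ g : UnitAddTorus (Fin 2) → EuclideanSpace ℝ (Fin 2),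
      Torus.IsSmooth g → Torus.IsDivFree g → Torus.HasZeroMean g →
      ∀ (ν : ℕ → ℝ) (v₀ : ℕ → UnitAddTorus (Fin 2) → EuclideanSpace ℝ (Fin 2))
        (v : ℕ → ℝ → UnitAddTorus (Fin 2) → EuclideanSpace ℝ (Fin 2)),
        (∀ j, 0 < ν j) → Tendsto ν atTop (𝓝 0) →
        (∀ j, Torus.IsGlobalLerayHopf (ν j) (fun _ => g) (v₀ j) (v j)) →
        (∃ E : ℝ, ∀ j, meanEnergy (v j) ≤ E) →
        Tendsto (fun j => longTimeAvgSup (fun t => Real.sqrt (Torus.eGradNormSq (v j t)).toReal) /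
          Real.log (ν j)⁻¹) atTop (𝓝 0)) ↔
    Summit.AnomalousDissipation.AnomalousDissipation.Theorems.TwohalfdThesis.Negative.SubLogStrain :=
  Iff.rfl

/-- **Child 2 is a theorem** (the per-family engine S4 ⇒ S5' ⇒ S3',
`PerForce.scalarNoAnomaly_of_subLogStrain_family`). [folklore] -/
theorem sub₂_holds :
    ∀ (g : UnitAddTorus (Fin 2) → EuclideanSpace ℝ (Fin 2)) (h : UnitAddTorus (Fin 2) → ℝ),
      Torus.IsSmooth g → Torus.IsDivFree g → Torus.HasZeroMean g →
      Torus.IsSmooth h → Torus.HasZeroMean h →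
      ∀ (ν : ℕ → ℝ) (v₀ : ℕ → UnitAddTorus (Fin 2) → EuclideanSpace ℝ (Fin 2))
        (v : ℕ → ℝ → UnitAddTorus (Fin 2) → EuclideanSpace ℝ (Fin 2))
        (θ₀ : ℕ → UnitAddTorus (Fin 2) → ℝ) (θ : ℕ → ℝ → UnitAddTorus (Fin 2) → ℝ),
        (∀ j, 0 < ν j) → Tendsto ν atTop (𝓝 0) →
        (∀ j, Torus.IsGlobalLerayHopf (ν j) (fun _ => g) (v₀ j) (v j)) →
        (∃ E : ℝ, ∀ j, meanEnergy (v j) ≤ E) →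
        Tendsto (fun j => longTimeAvgSup (fun t => Real.sqrt (Torus.eGradNormSq (v j t)).toReal) /
          Real.log (ν j)⁻¹) atTop (𝓝 0) →
        (∀ j, MemLp (θ₀ j) 2 volume) →
        (∀ j, Torus.IsWeakScalarTransportForced (ν j) (v j) (fun _ => h) (θ₀ j) (θ j)) →
        (∃ E : ℝ, ∀ j, longTimeAvgSup (fun t => Torus.scalarL2Sq (θ j t)) ≤ E) →
        Tendsto (fun j => longTimeAvgSup (fun t => ν j * (Torus.eScalarGradNormSq (θ j t)).toReal))
          atTop (𝓝 0) :=
  PerForce.scalarNoAnomaly_of_subLogStrain_family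

/-- **The crux modulo child 1 alone** (child 2 discharged by `sub₂_holds`): the decomposition loses
nothing against the landed conditional closure `RegularCondensate.twohalfdNeg_of_SubLogStrainConjecture`. [folklore] -/
theorem twohalfdNeg_of_sub₁
    (hS6 : Summit.AnomalousDissipation.AnomalousDissipation.Theorems.TwohalfdThesis.Negative.SubLogStrain) :
    Summit.AnomalousDissipation.AnomalousDissipation.Theses.TwoAndHalfD.TwohalfdNeg :=
  TwohalfdNeg_of_subs (sub₁_iff_subLogStrain.mpr hS6) sub₂_holds

end Summit.AnomalousDissipation.AnomalousDissipation.Theorems.TwohalfdNeg.Split
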